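import Summits.Ventures.Crystal3D.Theorems.StickyWulffConstantNoReconstructionGainOffRegistryDegenerate
import HarnessLib

/-!
# The atom at every normal for films whose off-lattice balls have at most six contacts

HONEST FRAMING. Part of the venture `Summits/Ventures/Crystal3D` (cell `crystal3d-full`), helper
`--supports` the crux `NoReconstructionGain` (stmt-Ventures-19144, route
`route-Ventures-StickyWulffConstant`), line `adhesion`.  A one-step corollary of g5's R26 rung
`offRegistrySixDegenerate_adhesion` (the atom, every normal `ν`, `R = 1`, `C = 0`, whenever the
OFF-LATTICE part of the film is plug-relatively 6-degenerate), recorded because it is the cleanest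
coordination-capped class that holds at EVERY normal (the coordination-`≤ 9` / `≤ 8` rungs are
specific to the `(111)` / `(100)` orbits):

* `lowCoordOffLattice_six_adhesion` — for every unit `ν`, every `ρ ≥ 1`, every finite unit packing
  `X ⊇ P` (`P` the `ν`-slab sample of `Λ₀`) in which every film ball OFF the lattice `Λ₀` has at most
  SIX contacts in `X` (film balls ON the lattice — registry continuation, steps, islands — are
  unrestricted): `#cross(P, X∖P) ≤ contactDeficiency (X∖P)`.

Proof: a ball with `≤ 6` contacts in `X` has, in particular, `≤ 6` partners among any set of
off-lattice balls together with its lattice partners, which is the 6-degeneracy hypothesis.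

WHAT THIS IS NOT: nothing about off-lattice balls of coordination `≥ 7`; rung F-C1 not moved.
-/

noncomputable section

namespace Summit.Ventures.Crystal3D.Theorems

open Summit.Ventures.Crystal3D Finset
open Literature.MathematicalPhysics.StatisticalMechanics (fccStacking orderedContacts contactDeficiency)
open scoped InnerProductSpace

/-- **The atom at every normal for films whose off-lattice balls have coordination `≤ 6`**
(`R = 1`, `C = 0`; lattice film balls unrestricted). -/
theorem lowCoordOffLattice_six_adhesion :
    ∃ R C : ℝ, 1 ≤ R ∧ ∀ ν : EuclideanSpace ℝ (Fin 3), ‖ν‖ = 1 → ∀ ρ : ℝ, R ≤ ρ →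
      ∀ X P : Finset (EuclideanSpace ℝ (Fin 3)),
      (∀ p ∈ X, ∀ q ∈ X, p ≠ q → 1 ≤ dist p q) → P ⊆ X →
      (∀ p, p ∈ P ↔ (p ∈ Literature.MathematicalPhysics.StatisticalMechanics.fccStacking 1
        (Real.sqrt (2 / 3)) ∧ -(2 * R) ≤ ⟪p, ν⟫_ℝ ∧ ⟪p, ν⟫_ℝ ≤ -R ∧ ‖p‖ ^ 2 - ⟪p, ν⟫_ℝ ^ 2 ≤ ρ ^ 2)) →
      (∀ q ∈ X \ P,
        q ∉ Literature.MathematicalPhysics.StatisticalMechanics.fccStacking 1 (Real.sqrt (2 / 3)) →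
          (X.filter fun x => dist q x = 1).card ≤ 6) →
      ((((P ×ˢ (X \ P)).filter fun pq => dist pq.1 pq.2 = 1).card : ℕ) : ℝ) ≤
        Literature.MathematicalPhysics.StatisticalMechanics.contactDeficiency (X \ P) + C * ρ := by
  classical
  obtain ⟨R, C, hR, h⟩ := offRegistrySixDegenerate_adhesion
  refine ⟨R, C, hR, fun ν hν ρ hρ X P hX hPX hP hdeg => h ν hν ρ hρ X P hX hPX hP ?_⟩
  intro S hS hoff hne
  obtain ⟨q, hq⟩ := hne
  refine ⟨q, hq, fun L hLX hL => ?_⟩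
  have hqX : q ∈ X \ P := hS hq
  have h6 := hdeg q hqX (hoff q hq)
  -- the `S`-partners and the lattice partners of `q` are disjoint sets of contacts of `q` in `X`
  have hsub : (S.filter fun x => dist q x = 1) ∪ L ⊆ X.filter fun x => dist q x = 1 := by
    intro x hx
    rw [mem_union] at hx
    rw [mem_filter]
    rcases hx with hx | hx
    · rw [mem_filter] at hx
      exact ⟨sdiff_subset (hS hx.1), hx.2⟩
    · exact ⟨hLX hx, (hL x hx).2⟩
  have hdisj : Disjoint (S.filter fun x => dist q x = 1) L := by
    rw [disjoint_left]
    intro x hx hxL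
    rw [mem_filter] at hx
    exact hoff x hx.1 (hL x hxL).1
  calc (S.filter fun x => dist q x = 1).card + L.card
      = ((S.filter fun x => dist q x = 1) ∪ L).card := (card_union_of_disjoint hdisj).symm
    _ ≤ (X.filter fun x => dist q x = 1).card := card_le_card hsub
    _ ≤ 6 := h6

end Summit.Ventures.Crystal3D.Theorems
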